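import Literature.NumberTheory.EllipticCurves.HeightCovolumeBoundsProofs
import Literature.NumberTheory.EllipticCurves.NewformPeterssonSizeRankinSelbergProofs
import HarnessLib

/-!
# Watkins (2004), Theorem 5.1 (as proved in print) from Lemma 3.4 in Rankin–Selberg form

Companion to `HeightCovolumeBounds.lean` (the named fact
`Literature.NumberTheory.EllipticCurves.watkins2004_thm_5_1`, M. Watkins, *Explicit lower bounds on
the modular degree of an elliptic curve*, arXiv:math/0408126, Theorem 5.1) and to
`HeightCovolumeBoundsProofs.lean`, which proves the corrected Theorem 5.1 (the printed first
inequality carries a slip of `2π`, see that file's module docstring) from its single analytic input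
in PETERSSON form, `(f, f) ≥ 0.033 N/(16π³ log N)`
(`watkins2004_thm_5_1.corrected_of_petersson_lower_bound`). Theorems only (no definition, no
named fact).

Here that input is moved one step closer to the paper. §1 of [Watkins2004] starts from Shimura's
identity `deg φ = (N c²/(2πΩ)) · L(Sym² E, 1)` (semistable `E`, `Ω = covol Λ_E`), which through
Zagier's `deg · Ω = 4π² c² (f, f)` (proved in the tree) reads `(f, f) = N · L(Sym² E, 1)/(8π³)`; the
classical route to it is Rankin's theorem — the Dirichlet series `D(w) = Σₙ |aₙ|² n^{-w}` of
`f ∈ S₂(Γ₀(N))` has a simple "pole" at `w = 2` with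
`Res_{w=2} D = 48π (f, f)/[SL₂(ℤ) : Γ₀(N)]` — and Rankin's theorem on `Γ₀(N)` is now PROVED in the
tree (`ModularForms.tendsto_sub_two_mul_tsum_normSq_cuspCoeff_div_rpow`,
`NewformPeterssonSizeRankinSelbergProofs.lean`, on top of `Gamma0RankinSelbergResidue.lean`). With
`ψ(N) = [SL₂(ℤ) : Γ₀(N)] = gamma0Index N` the two identities combine to the dictionary

  `L(Sym² f_E, 1) = 8π³ (f, f)/N = (π²/6) · (ψ(N)/N) · Res_{w=2} Σₙ |aₙ|² n^{-w}`

(for squarefree `N` this is also what the Euler products give directly: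
`D(w) = ζ^{(N)}(w−1) L(Sym² f_E, w−1)/ζ^{(N)}(2w−2)` with `|a_{p^k}|² = 1` at `p ∣ N`, so
`Res_{w=2} D = L(Sym² f_E, 1) ∏_{p∣N}(1 − 1/p)/ζ^{(N)}(2) = L(Sym² f_E, 1)/(ζ(2) ∏_{p∣N}(1 + 1/p))`
and `ψ(N)/N = ∏_{p∣N}(1 + 1/p)`). Hence Lemma 3.4 of the paper for a semistable curve,
`L(Sym² f_E, 1) ≥ 0.033/log N^{(2)} = 0.033/(2 log N)`, is, in the tree's language, the inequality

  `(π²/6) · (gamma0Index N / N) · R ≥ 0.033/(2 log N)`,  `R = lim_{w→2⁺} (w − 2) Σₙ |aₙ(f_E)|² n^{-w}`,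

and from it BOTH inequalities of the corrected Theorem 5.1 follow
(`watkins2004_thm_5_1.corrected_of_rankinSelberg_residue_lower_bound`): the residue `R` determines
`(f, f) = ψ(N) R/(48π)` (`ModularForms.peterssonProduct_re_eq_of_tendsto_div_rpow`), and
`HeightCovolumeBoundsProofs` does the rest (Zagier, `c² ≥ 1`, Lemma 2.1, `N ≤ |Δ_min|`, arithmetic).

What remains outside the tree is therefore exactly Lemma 3.4 itself (the explicit
Goldfeld–Hoffstein–Lieman zero-free region for `L(Sym² f_E, s)`, Lemmas 3.1–3.4 of the paper, which
need the analytic continuation and functional equation of `L(Sym² f_E, s)` and of `L(Sym⁴ f_E, s)`);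
it is kept as an explicit hypothesis, no named fact is introduced (D-0026).

## References

* [Watkins2004] M. Watkins, *Explicit lower bounds on the modular degree of an elliptic curve*,
  arXiv:math/0408126 — §1 (Shimura's identity), Lemma 3.4, §4, Theorem 5.1.
* [Murty1999CongruencePrimes] M. R. Murty, *Bounds for congruence primes* (1999), §2 (Rankin–Selberg
  for `(f, f)`).
* R. A. Rankin, Proc. Cambridge Philos. Soc. 35 (1939), 357–372.
-/

noncomputable section

open scoped MatrixGroups ModularForm Real Topology
open Filter CongruenceSubgroup
open Literature.NumberTheory.EllipticCurves.ModularForms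

namespace Literature.NumberTheory.EllipticCurves

/-- **The Petersson norm from Rankin's residue (classical normalisation).** For `f ∈ S₂(Γ₀(N))`:
if `(w − 2) Σₙ |aₙ|² n^{-w} → R` as `w → 2⁺`, then `Re (f, f) = gamma0Index N · R/(48π)`
(uniqueness of limits with the tree's `tendsto_sub_two_mul_tsum_normSq_cuspCoeff_div_rpow`,
`Res_{w=2} Σ|aₙ|²n^{-w} = 48π (f,f)/[SL₂(ℤ):Γ₀(N)]`). [cite: Murty1999CongruencePrimes, §2; Watkins2004, §1] -/
theorem ModularForms.peterssonProduct_re_eq_of_tendsto_div_rpow {N : ℕ} [NeZero N]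
    (f : CuspForm (Gamma0 N) 2) {R : ℝ}
    (hR : Tendsto (fun w : ℝ ↦ (w - 2) * ∑' n : ℕ, ‖cuspCoeff f n‖ ^ 2 / (n : ℝ) ^ w)
      (𝓝[>] 2) (𝓝 R)) :
    (peterssonProduct (Gamma0 N) 2 f f).re = gamma0Index N * R / (48 * π) := by
  have h := tendsto_nhds_unique (tendsto_sub_two_mul_tsum_normSq_cuspCoeff_div_rpow f) hR
  have hπ : (π : ℝ) ≠ 0 := Real.pi_ne_zero
  have hg : (gamma0Index N : ℝ) ≠ 0 := by exact_mod_cast (gamma0Index_pos N).ne'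
  rw [div_eq_iff hg] at h
  rw [eq_div_iff (mul_ne_zero (by norm_num) hπ)]
  linear_combination h

/-- **[Watkins2004], Theorem 5.1 as established by its printed proof, from Lemma 3.4 in
Rankin–Selberg form.** Let `W/ℚ` be globally minimal with conductor `N ≥ 20000` and `D` a
parametrisation datum at level `N` with newform `f = D.f`, and let
`R = lim_{w→2⁺} (w − 2) Σₙ |aₙ(f)|² n^{-w}` be Rankin's residue (it exists:
`tendsto_sub_two_mul_tsum_normSq_cuspCoeff_div_rpow`). If

  `(π²/6) · (gamma0Index N / N) · R ≥ 0.033/(2 log N)`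

— which for semistable `E` is Lemma 3.4 of the paper, `L(Sym² f_E, 1) ≥ 0.033/log N^{(2)}`,
`N^{(2)} = N²`, through the dictionary `L(Sym² f_E, 1) = 8π³(f,f)/N = (π²/6)(ψ(N)/N) R` of §1 +
Zagier + Rankin (module docstring) — then both inequalities of the corrected Theorem 5.1 hold:
`deg ≥ (N/(2π covol Λ_E)) · 0.033/(2 log N)` and `deg ≥ N^{7/6}/(5350 log N)`.
Proof: `(f, f) = ψ(N) R/(48π) ≥ 0.033 N/(16π³ log N)` and
`watkins2004_thm_5_1.corrected_of_petersson_lower_bound`.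
[cite: Watkins2004, Theorem 5.1 with §1, Lemma 2.1, Lemma 3.4, §4] -/
theorem watkins2004_thm_5_1.corrected_of_rankinSelberg_residue_lower_bound
    (W : WeierstrassCurve ℚ) [W.IsElliptic] [W.IsGloballyMinimal] [NeZero (W.conductorNorm ℤ)]
    (hN : 20000 ≤ W.conductorNorm ℤ) (D : ModularParametrizationData W (W.conductorNorm ℤ))
    {R : ℝ}
    (hR : Tendsto (fun w : ℝ ↦ (w - 2) * ∑' n : ℕ, ‖cuspCoeff D.f n‖ ^ 2 / (n : ℝ) ^ w)
      (𝓝[>] 2) (𝓝 R))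
    (hL : 0.033 / (2 * Real.log (W.conductorNorm ℤ)) ≤
      π ^ 2 / 6 * ((gamma0Index (W.conductorNorm ℤ) : ℝ) / (W.conductorNorm ℤ : ℝ)) * R) :
    (W.conductorNorm ℤ : ℝ) / (2 * Real.pi * ZLattice.covolume D.L.lattice) *
          (0.033 / (2 * Real.log (W.conductorNorm ℤ))) ≤ (D.modularDegree : ℝ) ∧
      (W.conductorNorm ℤ : ℝ) ^ (7 / 6 : ℝ) / (5350 * Real.log (W.conductorNorm ℤ)) ≤
        (D.modularDegree : ℝ) := by
  refine watkins2004_thm_5_1.corrected_of_petersson_lower_bound W hN D ?_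
  rw [peterssonProduct_re_eq_of_tendsto_div_rpow D.f hR]
  have hN' : (20000 : ℝ) ≤ (W.conductorNorm ℤ : ℝ) := by exact_mod_cast hN
  have hN0 : (0 : ℝ) < (W.conductorNorm ℤ : ℝ) := by linarith
  have hlog : 0 < Real.log (W.conductorNorm ℤ : ℝ) := Real.log_pos (by linarith)
  have hπ : (0 : ℝ) < π := Real.pi_pos
  -- multiply `hL` by `N/(8π³) > 0`
  have key := mul_le_mul_of_nonneg_left hL (div_pos hN0 (by positivity : (0 : ℝ) < 8 * π ^ 3)).le
  calc 0.033 * (W.conductorNorm ℤ : ℝ) / (16 * π ^ 3 * Real.log (W.conductorNorm ℤ : ℝ))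
      = (W.conductorNorm ℤ : ℝ) / (8 * π ^ 3) * (0.033 / (2 * Real.log (W.conductorNorm ℤ : ℝ))) := by
        field_simp
        ring
    _ ≤ (W.conductorNorm ℤ : ℝ) / (8 * π ^ 3) *
          (π ^ 2 / 6 * ((gamma0Index (W.conductorNorm ℤ) : ℝ) / (W.conductorNorm ℤ : ℝ)) * R) := key
    _ = (gamma0Index (W.conductorNorm ℤ) : ℝ) * R / (48 * π) := by
        field_simp
        ring

end Literature.NumberTheory.EllipticCurves

end
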